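import Summits.Ventures.Crystal3D.Theorems.StickyWulffConstantCoaxialWallLawEndRowRatNarrow
import Summits.Ventures.Crystal3D.Theorems.StickyWulffConstantCoaxialWallLawSeamStarTwelveReading
import Summits.Ventures.Crystal3D.Theorems.StickyWulffConstantGenericWallFloorSaturationStructure
import HarnessLib

/-!
# FULL-CENSUS KIT: a `1`-separated configuration read through an affine copy of the rational `√18`-model — E1 steps, gap / separation /
# count closures in integer currency
# (crux `CoaxialWallLaw`, stmt-Ventures-19481; lane F 'Certificates' v8.4, registered stub `stub_satCensus11Full : TailResidue.SatCensus11Full`)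

HONEST FRAMING. Venture `Summits/Ventures/Crystal3D` (cell `crystal3d-full`); helper for `stub_satCensus11Full`.  Seat 19481-p2 g15's exact search
(HOME/wall-19481-p2/g15-calc/fullsearch2.py) shows that the deg-11 FULL-reader census closes under E1 (`P5Exhaustion`) CASCADED to every saturated shell
ball that acquires a closed slot star, GAP(5/2) and ONE twin vacancy census — no free-ball cap row is needed.  To put that finite analysis in the kernel
we read the configuration `X` through the affine map `T v = q₀ + G' (PQ v)` of the rational model of '…EndRowRatFrames' (`PQ`, `RatFrame`,
`mirQ`): every ball the cascade produces is `T v` for a rational `v`, every frame is `F.Φ.trans G'` for a `RatFrame F` reached from the base frame by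
reflections, and every geometric fact used is an integer inequality on `dq`.
* `T`, `T_injective`, `dist_T_sq`, `dist_T_eq_one_iff` (`dq Δ Δ = 18`), `one_le_dist_T_iff`, `dist_T_lt_five_fourths` ;
* `frameA F := F.Φ.trans G'`: `T_add_slot`, `menu_of_frameA`, `inner_frameA_slot`, `T_add_mirror`;
* **`e1_step`** — E1 at a saturated `T v` carrying the closed star of slot `j` in the frame `F`: either all twelve `T (v + F.g i)` are in `X` and
  every contact of `T v` is one of them, or for some cube normal `c` keeping the star on the own side the own slots and the three mirrors
  `T (v + mirQ F.g F.w i c)` are in `X`, the far slots are not, and every contact is one of those twelve;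
* closures: `false_of_sep` (two model balls closer than `1`), `false_of_gap` (a ball strictly inside the `5/4`-gap of a saturated ball),
  `false_of_twelve_contacts` (twelve model contacts at a ball of degree `11`).
WHAT THIS IS NOT: no census statement is proved here; F-C1 not moved.
-/

noncomputable section

namespace Summit.Ventures.Crystal3D.Theorems

namespace TailResidue

namespace FullCensus

open Summit.Ventures.Crystal3D Finset EndRowFloor NearIdentity
open scoped InnerProductSpace

variable {X : Finset (EuclideanSpace ℝ (Fin 3))} (G' : EuclideanSpace ℝ (Fin 3) ≃ₗᵢ[ℝ] EuclideanSpace ℝ (Fin 3)) (q₀ : EuclideanSpace ℝ (Fin 3))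

/-! ### The affine reading of the rational model -/

/-- The ball of the configuration sitting at the rational model point `v`: `T v = q₀ + G' (PQ v)`. -/
def T (v : Fin 3 → ℚ) : EuclideanSpace ℝ (Fin 3) := q₀ + G' (PQ v)

/-- `T` is injective. -/
theorem T_injective : Function.Injective (T G' q₀) := fun _ _ h => PQ_injective (G'.injective (add_left_cancel h))

/-- Distances under `T` are model distances. -/
theorem dist_T (u v : Fin 3 → ℚ) : dist (T G' q₀ u) (T G' q₀ v) = dist (iptQ u) (iptQ v) := by
  unfold T PQ
  rw [dist_eq_norm, dist_eq_norm, add_sub_add_left_eq_sub, ← map_sub, LinearIsometryEquiv.norm_map, ← map_sub, LinearIsometryEquiv.norm_map]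

/-- Squared distances under `T`: `dq Δ Δ / 18`. -/
theorem dist_T_sq (u v : Fin 3 → ℚ) : dist (T G' q₀ u) (T G' q₀ v) ^ 2 = ((dq (u - v) (u - v) : ℚ) : ℝ) / 18 := by
  rw [dist_T, dist_eq_norm, ← iptQ_sub, ← real_inner_self_eq_norm_sq, inner_iptQ]

/-- `dist (T u) (T v) = 1 ↔ dq (u − v) (u − v) = 18`. -/
theorem dist_T_eq_one_iff (u v : Fin 3 → ℚ) : dist (T G' q₀ u) (T G' q₀ v) = 1 ↔ dq (u - v) (u - v) = 18 := by
  have h := dist_T_sq G' q₀ u v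
  have hd : 0 ≤ dist (T G' q₀ u) (T G' q₀ v) := dist_nonneg
  constructor
  · intro h1
    rw [h1, one_pow] at h
    have : ((dq (u - v) (u - v) : ℚ) : ℝ) = 18 := by linarith
    exact_mod_cast this
  · intro h2
    rw [h2] at h
    have h' : dist (T G' q₀ u) (T G' q₀ v) ^ 2 = 1 := by rw [h]; push_cast; norm_num
    nlinarith

/-- `1 ≤ dist (T u) (T v) ↔ 18 ≤ dq (u − v) (u − v)`. -/
theorem one_le_dist_T_iff (u v : Fin 3 → ℚ) : 1 ≤ dist (T G' q₀ u) (T G' q₀ v) ↔ 18 ≤ dq (u - v) (u - v) := by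
  have h := dist_T_sq G' q₀ u v
  have hd : 0 ≤ dist (T G' q₀ u) (T G' q₀ v) := dist_nonneg
  constructor
  · intro h1
    have : (1 : ℝ) ≤ ((dq (u - v) (u - v) : ℚ) : ℝ) / 18 := by rw [← h]; nlinarith
    have : (18 : ℝ) ≤ ((dq (u - v) (u - v) : ℚ) : ℝ) := by linarith
    exact_mod_cast this
  · intro h2
    have : (18 : ℝ) ≤ ((dq (u - v) (u - v) : ℚ) : ℝ) := by exact_mod_cast h2
    nlinarith

/-- `dq (u − v) (u − v) < 225/8 → dist (T u) (T v) < 5/4`. -/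
theorem dist_T_lt_five_fourths {u v : Fin 3 → ℚ} (h : dq (u - v) (u - v) < 225 / 8) : dist (T G' q₀ u) (T G' q₀ v) < 5 / 4 := by
  have hsq := dist_T_sq G' q₀ u v
  have hd : 0 ≤ dist (T G' q₀ u) (T G' q₀ v) := dist_nonneg
  have : ((dq (u - v) (u - v) : ℚ) : ℝ) < (225 / 8 : ℚ) := by exact_mod_cast h
  push_cast at this
  nlinarith

/-! ### Frames -/

/-- The frame of the configuration attached to the rational frame `F`: `F.Φ` followed by `G'`. -/
def frameA (F : RatFrame) : EuclideanSpace ℝ (Fin 3) ≃ₗᵢ[ℝ] EuclideanSpace ℝ (Fin 3) := F.Φ.trans G'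

/-- Slot balls of the frame are model points: `T v + frameA F (slotSite i) = T (v + F.g i)`. -/
theorem T_add_slot (F : RatFrame) (v : Fin 3 → ℚ) (i : Fin 12) : T G' q₀ v + frameA G' F (slotSite i) = T G' q₀ (v + F.g i) := by
  unfold T frameA
  rw [LinearIsometryEquiv.trans_apply, add_assoc, ← map_add, PQ_add_slot]

/-- Every menu normal of `frameA F` is `G'` of one of the eight rational normals of `F`. -/
theorem menu_of_frameA (F : RatFrame) {m : EuclideanSpace ℝ (Fin 3)} (hm : IsMenuNormal (frameA G' F) m) : ∃ c : Fin 8, m = G' (nv (F.w c)) := by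
  unfold frameA at hm
  rw [isMenuNormal_trans_iff] at hm
  obtain ⟨c, hc⟩ := F.hmenu _ hm
  exact ⟨c, by rw [← hc, LinearIsometryEquiv.apply_symm_apply]⟩

/-- Slot/normal products in the frame are the integer menu values. -/
theorem inner_frameA_slot (F : RatFrame) (i : Fin 12) (c : Fin 8) :
    ⟪frameA G' F (slotSite i), G' (nv (F.w c))⟫_ℝ = (dz (slotInt i) (cubeInt c) : ℝ) / Real.sqrt 6 := by
  unfold frameA
  rw [LinearIsometryEquiv.trans_apply, G'.inner_map_map, F.hinner]

/-- Mirror balls of the frame are model points: `T v + (A sᵢ − 2⟪A sᵢ, n⟫ n) = T (v + mirQ F.g F.w i c)` for `n = G' (nv (F.w c))`. -/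
theorem T_add_mirror (F : RatFrame) (v : Fin 3 → ℚ) (i : Fin 12) (c : Fin 8) :
    T G' q₀ v + (frameA G' F (slotSite i) - (2 * ⟪frameA G' F (slotSite i), G' (nv (F.w c))⟫_ℝ) • G' (nv (F.w c))) =
      T G' q₀ (v + mirQ F.g F.w i c) := by
  rw [inner_frameA_slot]
  unfold T frameA
  rw [LinearIsometryEquiv.trans_apply, ← F.hinner, ← map_smul, ← map_sub, F.mirror_eq, add_assoc]
  unfold PQ
  rw [iptQ_add, map_add, map_add]

/-- The sign of `⟪A sᵢ, n⟫` is the sign of the integer menu value. -/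
theorem inner_frameA_slot_nonpos_iff (F : RatFrame) (i : Fin 12) (c : Fin 8) :
    ⟪frameA G' F (slotSite i), G' (nv (F.w c))⟫_ℝ ≤ 0 ↔ dz (slotInt i) (cubeInt c) ≤ 0 := by
  rw [inner_frameA_slot, div_nonpos_iff]
  have h6 : (0 : ℝ) < Real.sqrt 6 := sqrt6_pos
  constructor
  · rintro (⟨_, h⟩ | ⟨h, _⟩)
    · exact absurd h (not_le.2 h6)
    · exact_mod_cast h
  · intro h; exact Or.inr ⟨by exact_mod_cast h, h6.le⟩

/-- Strict version. -/
theorem inner_frameA_slot_neg_iff (F : RatFrame) (i : Fin 12) (c : Fin 8) :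
    ⟪frameA G' F (slotSite i), G' (nv (F.w c))⟫_ℝ < 0 ↔ dz (slotInt i) (cubeInt c) < 0 := by
  rw [inner_frameA_slot, div_neg_iff]
  have h6 : (0 : ℝ) < Real.sqrt 6 := sqrt6_pos
  constructor
  · rintro (⟨_, h⟩ | ⟨h, _⟩)
    · exact absurd h (not_lt.2 h6.le)
    · exact_mod_cast h
  · intro h; exact Or.inr ⟨by exact_mod_cast h, h6⟩

/-- Positive version. -/
theorem inner_frameA_slot_pos_iff (F : RatFrame) (i : Fin 12) (c : Fin 8) :
    0 < ⟪frameA G' F (slotSite i), G' (nv (F.w c))⟫_ℝ ↔ 0 < dz (slotInt i) (cubeInt c) := by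
  rw [← not_le, inner_frameA_slot_nonpos_iff, not_le]

/-! ### The E1 step in model currency -/

open scoped Classical in
/-- **E1 STEP.**  Under `P5Exhaustion`: `X` `1`-separated, `T v ∈ X` with twelve contacts, the closed star of slot `j` in the frame `F` occupied
(`T (v + F.g i) ∈ X` whenever `slotInt i · slotInt j > 0`).  Then EITHER all twelve slot balls `T (v + F.g i)` are in `X` and every contact of
`T v` is one of them, OR for some cube normal `c` with the star on its own side (`dz (slotInt i) (cubeInt c) ≤ 0` on the star) the nine own slot
balls and the three mirrors `T (v + mirQ F.g F.w i c)` are in `X`, the three far slot balls are NOT, and every contact is an own slot ball or a mirror. -/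
theorem e1_step (hE1 : P5Exhaustion) (hX : ∀ p ∈ X, ∀ p' ∈ X, p ≠ p' → 1 ≤ dist p p') {v : Fin 3 → ℚ}
    (h12 : (X.filter fun z => dist (T G' q₀ v) z = 1).card = 12) (F : RatFrame) (j : Fin 12)
    (hstar : ∀ i : Fin 12, 0 < dz (slotInt i) (slotInt j) → T G' q₀ (v + F.g i) ∈ X) :
    ((∀ i : Fin 12, T G' q₀ (v + F.g i) ∈ X) ∧ ∀ z ∈ X, dist (T G' q₀ v) z = 1 → ∃ i : Fin 12, z = T G' q₀ (v + F.g i)) ∨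
    ∃ c : Fin 8, (∀ i : Fin 12, 0 < dz (slotInt i) (slotInt j) → dz (slotInt i) (cubeInt c) ≤ 0) ∧
      (∀ i : Fin 12, dz (slotInt i) (cubeInt c) ≤ 0 → T G' q₀ (v + F.g i) ∈ X) ∧
      (∀ i : Fin 12, dz (slotInt i) (cubeInt c) < 0 → T G' q₀ (v + mirQ F.g F.w i c) ∈ X) ∧
      (∀ i : Fin 12, 0 < dz (slotInt i) (cubeInt c) → T G' q₀ (v + F.g i) ∉ X) ∧
      ∀ z ∈ X, dist (T G' q₀ v) z = 1 →
        (∃ i : Fin 12, dz (slotInt i) (cubeInt c) ≤ 0 ∧ z = T G' q₀ (v + F.g i)) ∨ (∃ i : Fin 12, dz (slotInt i) (cubeInt c) < 0 ∧ z = T G' q₀ (v + mirQ F.g F.w i c)) := by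
  have hslotball : ∀ i : Fin 12, T G' q₀ v + frameA G' F (slotSite i) = T G' q₀ (v + F.g i) := fun i => T_add_slot G' q₀ F v i
  -- the star hypothesis in the lane's form
  have hstar' : ∀ w ∈ fccSlots, 0 < ⟪w, slotSite j⟫_ℝ → T G' q₀ v + frameA G' F w ∈ X := by
    intro w hw hpos
    obtain ⟨i, rfl⟩ := exists_slotSite_eq hw
    rw [hslotball]
    refine hstar i ?_
    rw [inner_slotSite] at hpos
    have : (0 : ℝ) < ((slotInt i ⬝ᵥ slotInt j : ℤ) : ℝ) := by linarith
    have h' : (0 : ℤ) < slotInt i ⬝ᵥ slotInt j := by exact_mod_cast this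
    simpa [dz, dotProduct, Fin.sum_univ_three] using h'
  rcases shell_slots_or_twin_of_star_twelve hE1 (frameA G' F) hX (slotSite_mem j) hstar' h12 with hall | ⟨n, hn, hown, hall⟩
  · -- FULL
    left
    have hfull : IsFull X (frameA G' F) (T G' q₀ v) := isFull_of_contacts_slots (frameA G' F) h12 hall
    refine ⟨fun i => ?_, fun z hz hd => ?_⟩
    · rw [← hslotball]; exact hfull _ (slotSite_mem i)
    · obtain ⟨w, hw, rfl⟩ := hall z hz hd
      obtain ⟨i, rfl⟩ := exists_slotSite_eq hw
      exact ⟨i, hslotball i⟩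
  · -- TWIN
    right
    obtain ⟨c, hc⟩ := menu_of_frameA G' F hn
    have htw : IsTwinReading X (frameA G' F) n (T G' q₀ v) := isTwinReading_of_contacts_twin (frameA G' F) hn h12 hall
    subst hc
    refine ⟨c, fun i hi => ?_, fun i hi => ?_, fun i hi => ?_, fun i hi => ?_, fun z hz hd => ?_⟩
    · -- the star is on the own side: the star slot ball is a contact, hence own or mirror; mirror is impossible
      have hmem : T G' q₀ v + frameA G' F (slotSite i) ∈ X := by rw [hslotball]; exact hstar i hi
      have hd1 : dist (T G' q₀ v) (T G' q₀ v + frameA G' F (slotSite i)) = 1 := by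
        rw [dist_eq_norm, sub_add_cancel_left, norm_neg, LinearIsometryEquiv.norm_map, norm_eq_one_of_mem_fccSlots (slotSite_mem i)]
      rcases hall _ hmem hd1 with ⟨w', hw', hle', he⟩ | ⟨w', hw', hlt', he⟩
      · have : slotSite i = w' := (frameA G' F).injective (add_left_cancel he)
        rw [← this, inner_frameA_slot_nonpos_iff] at hle'
        exact hle'
      · exact absurd (add_left_cancel he) (slot_ne_mirror (frameA G' F) hn (slotSite_mem i) hw' hlt')
    · rw [← hslotball]
      exact htw.2.1 _ (slotSite_mem i) ((inner_frameA_slot_nonpos_iff G' F i c).2 hi)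
    · have h := htw.2.2.1 _ (slotSite_mem i) ((inner_frameA_slot_neg_iff G' F i c).2 hi)
      rw [T_add_mirror] at h
      exact h
    · rw [← hslotball]
      exact htw.2.2.2 _ (slotSite_mem i) ((inner_frameA_slot_pos_iff G' F i c).2 hi)
    · rcases hall z hz hd with ⟨w', hw', hle', rfl⟩ | ⟨w', hw', hlt', rfl⟩
      · obtain ⟨i, rfl⟩ := exists_slotSite_eq hw'
        exact Or.inl ⟨i, (inner_frameA_slot_nonpos_iff G' F i c).1 hle', hslotball i⟩
      · obtain ⟨i, rfl⟩ := exists_slotSite_eq hw'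
        exact Or.inr ⟨i, (inner_frameA_slot_neg_iff G' F i c).1 hlt', T_add_mirror G' q₀ F v i c⟩

/-! ### Closures in integer currency -/

/-- **Separation closure**: two distinct model balls of `X` at model distance² `< 18` contradict `1`-separation. -/
theorem false_of_sep (hX : ∀ p ∈ X, ∀ p' ∈ X, p ≠ p' → 1 ≤ dist p p') {u v : Fin 3 → ℚ} (hu : T G' q₀ u ∈ X) (hv : T G' q₀ v ∈ X) (hne : u ≠ v)
    (hlt : dq (u - v) (u - v) < 18) : False := by
  have h := hX _ hu _ hv (fun h => hne (T_injective G' q₀ h))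
  rw [one_le_dist_T_iff] at h
  exact absurd hlt (not_lt.2 h)

open scoped Classical in
/-- **Gap closure**: under GAP(5/2), no ball of `X` sits at model distance² strictly between `18` and `225/8` from a saturated model ball. -/
theorem false_of_gap (hg : KissingGap (5 / 2)) (hX : ∀ p ∈ X, ∀ p' ∈ X, p ≠ p' → 1 ≤ dist p p') {p x : Fin 3 → ℚ} (hp : T G' q₀ p ∈ X)
    (h12 : (X.filter fun z => dist (T G' q₀ p) z = 1).card = 12) (hx : T G' q₀ x ∈ X) (hlo : 18 < dq (p - x) (p - x)) (hhi : dq (p - x) (p - x) < 225 / 8) :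
    False := by
  rcases eq_or_dist_eq_one_or_le_dist_of_saturated hg hX hp h12 hx with h | h | h
  · have : x = p := T_injective G' q₀ h
    rw [this, sub_self] at hlo
    norm_num [dq] at hlo
  · rw [dist_T_eq_one_iff] at h; rw [h] at hlo; exact lt_irrefl _ hlo
  · have hlt := dist_T_lt_five_fourths G' q₀ (u := p) (v := x) hhi
    linarith

open scoped Classical in
/-- **Count closure**: twelve distinct model balls of `X` at model distance `1` from `T b` contradict `deg (T b) = 11`. -/
theorem false_of_twelve_contacts (L : List (Fin 3 → ℚ)) (hnd : L.Nodup) (hlen : 12 ≤ L.length) {b : Fin 3 → ℚ}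
    (hmem : ∀ v ∈ L, T G' q₀ v ∈ X) (hcontact : ∀ v ∈ L, dq (b - v) (b - v) = 18)
    (h11 : (X.filter fun z => dist (T G' q₀ b) z = 1).card = 11) : False := by
  set C := X.filter fun z => dist (T G' q₀ b) z = 1 with hC
  set I := (L.map (T G' q₀)).toFinset with hI
  have hIC : I ⊆ C := by
    intro z hz
    rw [hI, List.mem_toFinset, List.mem_map] at hz
    obtain ⟨v, hv, rfl⟩ := hz
    exact mem_filter.2 ⟨hmem v hv, (dist_T_eq_one_iff G' q₀ b v).2 (hcontact v hv)⟩
  have hIcard : I.card = L.length := by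
    rw [hI, List.card_toFinset, (List.nodup_map_iff (T_injective G' q₀)).2 hnd |>.dedup, List.length_map]
  have := card_le_card hIC
  rw [hIcard, h11] at this
  omega

end FullCensus

end TailResidue

end Summit.Ventures.Crystal3D.Theorems

end
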